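import Summits.HubbardSuperconductivity.HubbardSuperconductivity.Theorems.BalabanIRBirComplexStableXYRStubUnfoldedLiftIdentity
import Summits.HubbardSuperconductivity.HubbardSuperconductivity.Theorems.BalabanIRBirComplexStableXYRSpinWaveSector
import Summits.HubbardSuperconductivity.HubbardSuperconductivity.Theorems.BalabanIRBirComplexStableXYFixedVolumeAction
import HarnessLib

/-!
# Route `BalabanIR`, crux `BirComplexStableXYR` (item `stmt-HubbardSuperconductivity-14845`),
# line `fat-gaussian-defect-calculus`: stub R8 `stub_unfoldedPartZ`

Helper (`--supports`) for the crux
`Summit.HubbardSuperconductivity.HubbardSuperconductivity.Theses.BalabanIR.BirComplexStableXYR`,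
line `fat-gaussian-defect-calculus` (lead skeleton `Cruxes/BirComplexStableXYR/Lines/fat_gaussian_defect_calculus.lean`),
stub R8 `stub_unfoldedPartZ`: **the unfolded partition function** (chapter 1 = exact Fröhlich–Spencer unfolding of
`partZ = ∫_{[0,2π]^Λ} e^{−A}` on the engine's torus `Λ L M = (ℤ/L)² × ℤ/M` with its space–time chart
`TorusChart.piProdZMod 2 L M`).

**Statement.** For every table `c`, coupling `K`, torus `Λ L M` and smoothing width `v ≠ 0`, `partZ K c L M` is the
`HasSum`, over the integer `1`-cochains `a` in TREE GAUGE (vanishing on the axial comb tree of the chart), of the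
integrals over the PINNED field space `{φ : φ 0 ∈ [0,2π)}` of the Gibbs factor `e^{−A(φ)}` times the smoothed-box bond
weight `Π_{x,i} χ_v(d₀φ(x,i) − 2π a(x,i))`, `χ_v(s) = ∫_{[-π,π]} g_v(s − t) dt`.

**Proof.** The landed generic unfolded lift identity `stub_unfoldedLiftIdentity` (stub U3) applied to
`g = e^{−A}`, which is continuous (`birAct_continuous_action`) and `2πℤ^Λ`-periodic (`cexp_neg_action_add_zsmul`);
its value `∫_{[0,2π)^Λ} e^{−A}` is `partZ` because the half-open and the closed cube agree almost everywhere
(`TorusChart.cubeIco_ae_eq_cubeIcc`, `MeasureTheory.setIntegral_congr_set`).  No definition and no named fact is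
introduced; sorry-free. [folklore]
-/

set_option linter.dupNamespace false -- summit = problem name (single-conjunct summit), D-0017

namespace Summit.HubbardSuperconductivity.HubbardSuperconductivity.Theorems.FSUnfolding

open scoped BigOperators
open MeasureTheory Literature.MathematicalPhysics.QuantumFieldTheory Literature.Probability.LatticeModels
open Summit.HubbardSuperconductivity.BirComplexStableXYNegative

variable {r : ℕ}

/-- **The Gibbs factor `θ ↦ e^{−A(θ)}` is continuous** (the window action is a finite sum of continuous local
generating functions, `birAct_continuous_action`). [folklore] -/
theorem continuous_cexp_neg_action (K : ℝ) (c : Table r) (L M : ℕ) [NeZero L] [NeZero M] :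
    Continuous fun θ : Λ L M → ℝ => Complex.exp (-(action K c L M θ)) := by
  have h := birAct_continuous_action c (F := genF c) (fun φ => rfl) (sh L M)
  simp only [action]
  exact Complex.continuous_exp.comp ((continuous_const.mul h).neg)

/-- **The Gibbs factor is `2πℤ^Λ`-periodic**, in the additive form `φ + 2π n` used by the unfolding
(`cexp_neg_action_add_zsmul`, `n x • 2π = 2π * n x`). [folklore] -/
theorem cexp_neg_action_add_two_pi_mul (K : ℝ) (c : Table r) (L M : ℕ) [NeZero L] [NeZero M]
    (φ : Λ L M → ℝ) (n : Λ L M → ℤ) :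
    Complex.exp (-(action K c L M (fun x => φ x + 2 * Real.pi * (n x : ℝ)))) =
      Complex.exp (-(action K c L M φ)) := by
  have hfun : (fun x => φ x + 2 * Real.pi * (n x : ℝ)) = fun x => φ x + n x • (2 * Real.pi) := by
    funext x
    rw [zsmul_eq_mul, mul_comm]
  rw [hfun]
  exact cexp_neg_action_add_zsmul K c L M n φ

/-- **`partZ` over the half-open cube.**  The closed cube `[0,2π]^Λ` of `partZ` and the half-open cube `[0,2π)^Λ`
differ by a Lebesgue-null set (`TorusChart.cubeIco_ae_eq_cubeIcc`), so `partZ = ∫_{[0,2π)^Λ} e^{−A}`. [folklore] -/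
theorem partZ_eq_setIntegral_cubeIco (K : ℝ) (c : Table r) (L M : ℕ) [NeZero L] [NeZero M] :
    partZ K c L M = ∫ φ in Set.pi Set.univ (fun _ : Λ L M => Set.Ico (0:ℝ) (2 * Real.pi)),
      Complex.exp (-(action K c L M φ)) := by
  unfold partZ
  exact (setIntegral_congr_set (TorusChart.cubeIco_ae_eq_cubeIcc (Λ := Λ L M))).symm

/-- **Stub R8 `stub_unfoldedPartZ` (registered signature, verbatim): the unfolded partition function.**  `partZ` is
the `HasSum`, over tree-gauge integer `1`-cochains `a`, of the pinned integrals of the Gibbs factor times the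
smoothed-box bond weight of `d₀φ − 2πa` (`stub_unfoldedLiftIdentity` for `g = e^{−A}`, continuous
(`continuous_cexp_neg_action`) and `2πℤ^Λ`-periodic (`cexp_neg_action_add_two_pi_mul`); the crux's closed cube and the
half-open cube differ by a null set, `partZ_eq_setIntegral_cubeIco`). [folklore] -/
theorem stub_unfoldedPartZ :
    ∀ (r : ℕ) (K : ℝ) (c : Table r) (L M : ℕ) [NeZero L] [NeZero M] (v : NNReal), v ≠ 0 →
      HasSum (fun a : {a : Λ L M → Fin 3 → ℤ // ∀ (y : Λ L M) (μ : Fin 3),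
            (∀ ν : Fin 3, μ < ν → (TorusChart.piProdZMod 2 L M).cval ν y = 0) →
            (TorusChart.piProdZMod 2 L M).cval μ y + 1 < (TorusChart.piProdZMod 2 L M).period μ → a y μ = 0} =>
          ∫ φ in {φ : Λ L M → ℝ | φ 0 ∈ Set.Ico 0 (2 * Real.pi)},
            Complex.exp (-(action K c L M φ)) *
              ∏ x : Λ L M, ∏ i : Fin 3, ((∫ t in Set.Icc (-Real.pi) Real.pi, ProbabilityTheory.gaussianPDFReal 0 v
                ((TorusChart.piProdZMod 2 L M).d₀ φ x i - 2 * Real.pi * (a.1 x i : ℝ) - t) : ℝ) : ℂ))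
        (partZ K c L M) := by
  intro r K c L M _ _ v hv
  rw [partZ_eq_setIntegral_cubeIco]
  exact stub_unfoldedLiftIdentity (Λ L M) 3 (TorusChart.piProdZMod 2 L M) v hv
    (fun φ => Complex.exp (-(action K c L M φ)))
    (continuous_cexp_neg_action K c L M) (cexp_neg_action_add_two_pi_mul K c L M)

end Summit.HubbardSuperconductivity.HubbardSuperconductivity.Theorems.FSUnfolding
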